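import Summits.QuantumFields.YangMills.Theorems.BalabanUVNodesK0Stub3FinVolPeriodicity
import Summits.QuantumFields.YangMills.Theorems.BalabanUVNodesK0V19Stub2Prime
import Summits.QuantumFields.YangMills.Theorems.BalabanUVNodesD4KernelDecayOfWindowed

/-!
# K0⁷ V19 — STUB 3ᴬ′, THE FINITE-VOLUME FACE (FILE 2 of 2): THE REPAIRED FINITE-VOLUME CURRENCIES — UNIFORM eventually-in-`K` ∕ FUNDAMENTAL-DOMAIN (5.10) and moments of the
# windowed finite-torus kernels on the boxes — ⟹ (5.10) for `polLimit` ⟹ the sign-free box of `β₁₃(θ)`, W1's windowed ∕ (D4) decay letters of record, and V19's socket 3ᴬ′ ∕ K0⁷ BY NAME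

Cell `pub-ymgap`, width seat `pub-ymgap-k0-s3-w2` (g2; director-ym R399 (3a) ∕ №207; bus CLAIM-1 ∕ INTENT-1 I.30390).  `--kind proof --supports stmt-QuantumFields-20541 --as helper`
(count-neutral).  NEW leaf; theorems only; 0 `def`; nothing modified; no registry write.  Imports FILE 1 `…K0Stub3FinVolPeriodicity` (ℤ⁴-periodicity of `polWindow`, growth of the tori
`sitesPerDir_tendsto_atTop`, the unfolding `betaOfRecord₁₃_eq_secondMoment_of_mem`, and the NEGATIVE CONTROL: K-uniform (5.10) ∕ all-finite-sets moments of `polWindow` on ℤ⁴ force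
`β₁₃ ≡ 0`), `…K0V19Stub2Prime` (V19's socket + K0⁷ by name, stub 2′ landed p595104) and n22's `…D4KernelDecayOfWindowed` (`kernelDecayOfRecord₁₃_of_windowed`, by name).
[I] = [Balaban1987RG1]; [II] = [Balaban1989LargeFieldII]; [III] = [Balaban1988Convergent]; [15] = [Balaban1985Variational].

TREE VOCABULARY USED (nothing re-declared).  W1's letters `Node00.U3KernelLetters`: `PolLimitsExistBox F ℰ ρ bV γ` ((1.21) exists at every box history — THE limit letter of this
file), `PolLimitsExistOfRecord₁₃ ∕ PolLimitsExistBoxOfRecord₁₃ ∕ WindowedDecayOfRecord₁₃` (record editions on `]0, θ.γ]`; per-SEQUENCE constants in the decay letter); (D4)'s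
`U3OfKernels.KernelDecayOfRecord₁₃`; `B12Sec2to5.Decay510 ∕ betaPrime510 ∕ secondMoment_abs_le_of_decay510`.  THE NEW CURRENCY (displayed inline, no `def`): the UNIFORM windowed
decay on a box window — ONE pair `(C, δ₁)` with `|Π_K(v; z)| ≤ C e^{−δ₁|z|₁}` for every level `k`, every history `v ∈ ]0, γ₀]^{k+1}`, every `z`, and all LARGE `K` (eventual form) —
resp. for EVERY `K` at the `z` of the centred FUNDAMENTAL WINDOW `2|z_i| < 2L^{m+K−k−1}` of `T^{(k+1)}` (print's torus reading of (5.10) [I] p.293).  Uniformity in the history is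
what the K0 box needs (one `β′`); W1's `WindowedDecay` is per-sequence and reaches a uniform `β′` only through NE9 + fading memory (k0-s3-w1's road p610322∕p611287).

§3 THE REPAIR (generic `F ℰ ρ bV`): (R1) eventual pointwise bounds + `PolLimitExists` ⟹ `Decay510 (polLimit …) C δ₁` (`le_of_tendsto` with an EVENTUALLY clause); (R2) fundamental-
domain bounds for every `K` ⟹ (R1) (`sitesPerDir_tendsto_atTop`); (R1′)∕(R2′) moment twins (Fatou for sums, with `Summable`).
§4 AT `θ`: (R1)∕(R2) on `]0, γ₀]`, `γ₀ ≤ θ.γ`, `δ₁ > 0`, + `PolLimitsExistBox … γ₀` ⟹ `BetaLowerH (−β′₅₁₀(4;C,δ₁)) γ₀ β₁₃(θ) ∧ BetaUpperH β′₅₁₀ γ₀ β₁₃(θ)`; moment twin (`β′ = M`);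
on the full design window the uniform currency PAYS W1's `WindowedDecayOfRecord₁₃ F N θ 0 1 δ₁` and — with `PolLimitsExistOfRecord₁₃` — (D4)'s `KernelDecayOfRecord₁₃ F N θ 0 1 δ₁`
BY NAME (n22's `kernelDecayOfRecord₁₃_of_windowed`), so one finite-volume delivery serves the K0 box AND the K3-keyed roads.
§5 AT V19's SOCKET: the fundamental-domain face at the collared witness `θ₁₅ᶜᶜᴹ(j; ε₀, ε₂₉; B₃, B₃′, a₀, a₁)` (design box `γ = ½`) ⟹ `K0V19Defs.AbsBetaBoxAtThm1WitnessCCMGenAt F`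
(★★★ `abs3A'_of_fundamentalDomainFaceAt`) and K0⁷ BY NAME from stub 1's text + the face (★★★ `record13SepCoPHInhabited_of_stub1_fundamentalDomainFaceAt_byName`).  By k0-s3-w2 g0's
`K0Stub3CubeLetterBlind` (p608905, `rfl`) the face need only be supplied at ONE representative letter per `(a₀, ε₂₉)`.

HONEST FRAMING.  Limits of real sequences, dominated sums and by-name compositions over landed files; NO β estimate; nothing of Bałaban asserted; the currencies (L) `PolLimitsExistBox`
∕ (FD) fundamental-domain decay are HYPOTHESES (displayed, inhabited nowhere in the tree — NODE O's analysis, [I] (1.7) p.261 ∕ §5 p.293); stub 3ᴬ′ NOT proved ([I] §1 p.264 «uniformly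
bounded» STATED, proof unpublished [II] p.355); stub 1 untouched; K0⁷ stmt-QuantumFields-20541 OPEN (V19 87879403b3a26109 stands); counts unmoved (typed 28∕28 · discharged 5∕28 — the chair's
words).  One finite 𝕋⁴ programme at fixed `ε = L^{−K}`, Bałaban AS PRINTED — NOT continuum ∕ ℝ⁴ ∕ OS ∕ mass gap ∕ Clay: the Yang–Mills mass gap is NOT proved by any of this; route R4
closes the CONDITIONAL finite-𝕋⁴ rung `BalabanLadder.UV` only.  No `sorry`, `def`, `instance`, `notation`, `axiom`.
-/

noncomputable section

open scoped Matrix.Norms.L2Operator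
open Filter Topology

namespace Summit.QuantumFields.YangMills.Theorems.K0Stub3FinVolFace

open Literature.MathematicalPhysics.QuantumFieldTheory.Balaban1983to89
open Literature.MathematicalPhysics.QuantumFieldTheory.Balaban1983to89.Node00
open Literature.MathematicalPhysics.QuantumFieldTheory.Balaban1983to89.T4Continuum
open Literature.MathematicalPhysics.QuantumFieldTheory.Balaban1983to89.FlowStep
open Literature.MathematicalPhysics.QuantumFieldTheory.Balaban1983to89.B12Sec2to5 (Decay510 l1 betaPrime510 secondMoment_abs_le_of_decay510)
open Literature.MathematicalPhysics.QuantumFieldTheory.Balaban1983to89.T4OutputRate (Window mem_window)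
open Literature.MathematicalPhysics.QuantumFieldTheory.Balaban1983to89.Node00.U3OfKernels (histPrefix KernelDecayOfRecord₁₃)
open Literature.MathematicalPhysics.QuantumFieldTheory.Balaban1983to89.Node00.U3KernelLetters (PolLimitsExistBox PolLimitsExistOfRecord₁₃
  PolLimitsExistBoxOfRecord₁₃ WindowedDecayOfRecord₁₃)
open Summit.QuantumFields.YangMills.Theorems.K0V19Defs (Prop8StepCoPAt AbsBetaBoxAtThm1WitnessCCMGenAt)
open Summit.QuantumFields.YangMills.Theorems.K0V19Stub2Prime (record13SepCoPHInhabited_of_stub1_stub3A'_byName)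
open Summit.QuantumFields.YangMills.Theorems.K0Stub3FinVolPeriodicity (sitesPerDir_tendsto_atTop box_mono_of_le betaOfRecord₁₃_eq_secondMoment_of_mem)
open YMDAG.N22.AtKernels (kernelDecayOfRecord₁₃_of_windowed)

/-! ## §3  THE REPAIR: eventually-in-`K` and fundamental-domain finite-volume currencies, and what they give for the LIMITING kernel -/

section Repair

variable {𝔄 : Type*} [NormedRing 𝔄] [NormedAlgebra ℝ 𝔄]
variable {V : Type*} [NormedAddCommGroup V] [NormedSpace ℝ V] {ι : Type*} [Fintype ι]

/-- **(R1) LIMITS INHERIT EVENTUAL POINTWISE DECAY**: if the printed limit (1.21) exists and, at each FIXED `z ∈ ℤ⁴`, the windowed finite-volume kernels obey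
`|Π_K(z)| ≤ C e^{−δ₁|z|₁}` for all LARGE `K` (large enough that `z` sits in the torus' fundamental window), then the limiting kernel obeys (5.10) with the same constants
(n22's `decay510_kernelA_of_windowed` is the `kernelA`-keyed twin). [cite: Balaban1987RG1, (1.21) p.264 and (5.10) p.293] -/
theorem decay510_polLimit_of_eventually (F : T4Family) (j : ℕ) (ℰ : (K : ℕ) → (Fin (F.P K).d → Site (F.P K) j → 𝔄) → ℝ)
    (ρ : V →L[ℝ] 𝔄) (bV : Module.Basis ι ℝ V) (μ ν : Fin 4) {C δ₁ : ℝ} (hL : PolLimitExists F j ℰ ρ bV)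
    (hK : ∀ z, ∀ᶠ K in atTop, |polWindow F K j (ℰ K) ρ bV μ ν z| ≤ C * Real.exp (-δ₁ * l1 z)) :
    Decay510 (polLimit F j ℰ ρ bV μ ν) C δ₁ := fun z =>
  le_of_tendsto ((tendsto_polLimit F j ℰ ρ bV hL μ ν z).abs) (hK z)

/-- **(R2) ⟹ (R1): FUNDAMENTAL-DOMAIN BOUNDS ARE EVENTUAL BOUNDS**: a bound valid for every `K` at every `z` of the centred fundamental window `2|z_i| < 2L^{m+K−j}` of
`T^{(j)}` (print's torus-distance reading of (5.10)) holds, at each fixed `z`, for all large `K` — the tori grow (`sitesPerDir_tendsto_atTop`).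
[cite: Balaban1987RG1, (5.10) p.293 and (1.21) p.264] -/
theorem eventually_bound_of_fundamentalDomain (F : T4Family) (j : ℕ) (ℰ : (K : ℕ) → (Fin (F.P K).d → Site (F.P K) j → 𝔄) → ℝ)
    (ρ : V →L[ℝ] 𝔄) (bV : Module.Basis ι ℝ V) (μ ν : Fin 4) (b : (Fin 4 → ℤ) → ℝ)
    (h : ∀ K (z : Fin 4 → ℤ), (∀ i, 2 * |z i| < ((F.P K).sitesPerDir j : ℤ)) → |polWindow F K j (ℰ K) ρ bV μ ν z| ≤ b z)
    (z : Fin 4 → ℤ) : ∀ᶠ K in atTop, |polWindow F K j (ℰ K) ρ bV μ ν z| ≤ b z := by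
  have ht : Tendsto (fun K => ((F.P K).sitesPerDir j : ℤ)) atTop atTop :=
    tendsto_natCast_atTop_atTop.comp (sitesPerDir_tendsto_atTop F j)
  have hall : ∀ᶠ K in atTop, ∀ i, 2 * |z i| < ((F.P K).sitesPerDir j : ℤ) :=
    eventually_all.mpr fun i => ht.eventually_gt_atTop (2 * |z i|)
  exact hall.mono fun K hK => h K z hK

/-- **(R2) for the limit**: K-uniform (5.10) on the FUNDAMENTAL WINDOWS + existence of the limit ⟹ (5.10) for the limiting kernel, same constants.
[cite: Balaban1987RG1, (5.10) p.293 and (1.21) p.264] -/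
theorem decay510_polLimit_of_fundamentalDomain (F : T4Family) (j : ℕ) (ℰ : (K : ℕ) → (Fin (F.P K).d → Site (F.P K) j → 𝔄) → ℝ)
    (ρ : V →L[ℝ] 𝔄) (bV : Module.Basis ι ℝ V) (μ ν : Fin 4) {C δ₁ : ℝ} (hL : PolLimitExists F j ℰ ρ bV)
    (h : ∀ K (z : Fin 4 → ℤ), (∀ i, 2 * |z i| < ((F.P K).sitesPerDir j : ℤ)) →
      |polWindow F K j (ℰ K) ρ bV μ ν z| ≤ C * Real.exp (-δ₁ * l1 z)) :
    Decay510 (polLimit F j ℰ ρ bV μ ν) C δ₁ :=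
  decay510_polLimit_of_eventually F j ℰ ρ bV μ ν hL
    (eventually_bound_of_fundamentalDomain F j ℰ ρ bV μ ν (fun z => C * Real.exp (-δ₁ * l1 z)) h)

/-- **(R1′) LIMITS INHERIT EVENTUAL WEIGHTED-MOMENT BOUNDS (Fatou for sums, with summability)**: if the limit (1.21) exists and for each FIXED finite `S ⊂ ℤ⁴` the partial sums
`Σ_{z∈S} |Π_K(z) z_μ z_ν|` are `≤ M` for all large `K`, then (1.22) of the limiting kernel converges absolutely and `|β| ≤ M`.  (`B12Beta.secondMoment` is a `tsum`, junk `0`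
off summability — hence the `Summable` conjunct.) [cite: Balaban1987RG1, (1.21)–(1.22) p.264] -/
theorem abs_secondMoment_polLimit_le_of_eventually (F : T4Family) (j : ℕ) (ℰ : (K : ℕ) → (Fin (F.P K).d → Site (F.P K) j → 𝔄) → ℝ)
    (ρ : V →L[ℝ] 𝔄) (bV : Module.Basis ι ℝ V) (μ ν : Fin 4) {M : ℝ} (hL : PolLimitExists F j ℰ ρ bV)
    (hM : ∀ S : Finset (Fin 4 → ℤ), ∀ᶠ K in atTop, ∑ z ∈ S, |polWindow F K j (ℰ K) ρ bV μ ν z * (z μ : ℝ) * (z ν : ℝ)| ≤ M) :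
    Summable (fun z : Fin 4 → ℤ => polLimit F j ℰ ρ bV μ ν z * (z μ : ℝ) * (z ν : ℝ)) ∧
      |B12Beta.secondMoment (polLimit F j ℰ ρ bV) μ ν| ≤ M := by
  set f : (Fin 4 → ℤ) → ℝ := fun z => polLimit F j ℰ ρ bV μ ν z * (z μ : ℝ) * (z ν : ℝ) with hf
  have hS : ∀ S : Finset (Fin 4 → ℤ), ∑ z ∈ S, |f z| ≤ M := by
    intro S
    have ht : Tendsto (fun K => ∑ z ∈ S, |polWindow F K j (ℰ K) ρ bV μ ν z * (z μ : ℝ) * (z ν : ℝ)|) atTop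
        (𝓝 (∑ z ∈ S, |f z|)) := by
      refine tendsto_finsetSum S fun z _ => ?_
      exact (((tendsto_polLimit F j ℰ ρ bV hL μ ν z).mul_const _).mul_const _).abs
    exact le_of_tendsto ht (hM S)
  have habs : Summable fun z => |f z| := summable_of_sum_le (fun z => abs_nonneg _) hS
  have hsum : Summable f := habs.of_abs
  refine ⟨hsum, ?_⟩
  have h1 : |∑' z, f z| ≤ ∑' z, |f z| := by
    have := norm_tsum_le_tsum_norm (f := f) (by simpa [Real.norm_eq_abs] using habs)
    simpa [Real.norm_eq_abs] using this
  exact h1.trans (habs.tsum_le_of_sum_le hS)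

/-- (R2′) ⟹ (R1′): partial-sum bounds for all finite `S` INSIDE the fundamental window of `T^{(j)}` hold, for each fixed finite `S ⊂ ℤ⁴`, for all large `K`.
[cite: Balaban1987RG1, (1.21)–(1.22) p.264] -/
theorem eventually_sumBound_of_fundamentalDomain (F : T4Family) (j : ℕ) (ℰ : (K : ℕ) → (Fin (F.P K).d → Site (F.P K) j → 𝔄) → ℝ)
    (ρ : V →L[ℝ] 𝔄) (bV : Module.Basis ι ℝ V) (μ ν : Fin 4) {M : ℝ}
    (h : ∀ K (S : Finset (Fin 4 → ℤ)), (∀ z ∈ S, ∀ i, 2 * |z i| < ((F.P K).sitesPerDir j : ℤ)) →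
      ∑ z ∈ S, |polWindow F K j (ℰ K) ρ bV μ ν z * (z μ : ℝ) * (z ν : ℝ)| ≤ M)
    (S : Finset (Fin 4 → ℤ)) :
    ∀ᶠ K in atTop, ∑ z ∈ S, |polWindow F K j (ℰ K) ρ bV μ ν z * (z μ : ℝ) * (z ν : ℝ)| ≤ M := by
  have ht : Tendsto (fun K => ((F.P K).sitesPerDir j : ℤ)) atTop atTop :=
    tendsto_natCast_atTop_atTop.comp (sitesPerDir_tendsto_atTop F j)
  have hall : ∀ᶠ K in atTop, ∀ z ∈ S, ∀ i, 2 * |z i| < ((F.P K).sitesPerDir j : ℤ) := by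
    refine S.eventually_all.mpr fun z _ => ?_
    exact eventually_all.mpr fun i => ht.eventually_gt_atTop (2 * |z i|)
  exact hall.mono fun K hK => h K S hK

/-- W1's box limit letter is monotone in the window: `PolLimitsExistBox … γ` ⟹ `PolLimitsExistBox … γ₀` for `γ₀ ≤ γ` (smaller boxes). [cite: Balaban1987RG1, (1.21) p.264 (bookkeeping)] -/
theorem polLimitsExistBox_mono (F : T4Family) (ℰ : TermFamily1 F 𝔄) (ρ : V →L[ℝ] 𝔄) (bV : Module.Basis ι ℝ V) {γ₀ γ : ℝ} (hle : γ₀ ≤ γ)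
    (h : PolLimitsExistBox F ℰ ρ bV γ) : PolLimitsExistBox F ℰ ρ bV γ₀ :=
  fun k v hv => h k v (box_mono_of_le hle hv)

end Repair

/-! ## §4  AT `θ` (generic `Stage13Params`): the repaired finite-volume faces ⟹ the sign-free box of `β₁₃(θ)`, W1's windowed decay letter and (D4)'s decay letter of record -/

section AtTheta

variable (F : T4Family) (N : ℕ) [NeZero N]

/-- **★★ THE FINITE-VOLUME FACE AT `θ`, uniform eventual form**: on a window `]0, γ₀]` inside the design box, W1's box limit letter (1.21) for the merged term of record
(`PolLimitsExistBox … γ₀`) AND ONE pair `(C, δ₁ > 0)` with K-EVENTUAL bounds `|Π_K(v; z)| ≤ C e^{−δ₁|z|₁}` on its windowed finite-torus kernels, for every level and box history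
⟹ the sign-free box `−β′ ≤ β₁₃(θ) ≤ β′` on `]0, γ₀]` with `β′ = β′₅₁₀(4; C, δ₁) = C·Σ_z |z|₁² e^{−δ₁|z|₁}` (`secondMoment_abs_le_of_decay510`).  CONDITIONAL; nothing asserted.
[cite: Balaban1987RG1, (1.20)–(1.22) p.264, (5.10) p.293, (5.42) p.297] -/
theorem absBox_betaOfRecord₁₃_of_uniformEventualDecayOnBox (θ : Stage13Params F N) {γ₀ C δ₁ : ℝ} (hle : γ₀ ≤ θ.γ) (hδ : 0 < δ₁)
    (hL : letI := θ.instVβ₁; letI := θ.instVβ₂; letI := θ.instιβ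
      PolLimitsExistBox F (mergedTermFamilyMatT F N (TβOfRecord₁₃ F N) (chiβOfRecord₁₃ F N θ) θ.εbg) θ.ρ8 θ.bV γ₀)
    (hD : letI := θ.instVβ₁; letI := θ.instVβ₂; letI := θ.instιβ
      ∀ k (v : Fin (k + 1) → ℝ), v ∈ Box γ₀ k → ∀ z, ∀ᶠ K in atTop,
        |polWindow F K (k + 1) (mergedTermFamilyMatT F N (TβOfRecord₁₃ F N) (chiβOfRecord₁₃ F N θ) θ.εbg k v K) θ.ρ8 θ.bV 0 1 z| ≤
          C * Real.exp (-δ₁ * l1 z)) :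
    BetaLowerH (-betaPrime510 4 C δ₁) γ₀ (betaOfRecord₁₃ F N θ) ∧ BetaUpperH (betaPrime510 4 C δ₁) γ₀ (betaOfRecord₁₃ F N θ) := by
  letI := θ.instVβ₁; letI := θ.instVβ₂; letI := θ.instιβ
  have key : ∀ k (v : Fin (k + 1) → ℝ), v ∈ Box γ₀ k → |betaOfRecord₁₃ F N θ k v| ≤ betaPrime510 4 C δ₁ := by
    intro k v hv
    rw [betaOfRecord₁₃_eq_secondMoment_of_mem F N θ (box_mono_of_le hle hv)]
    have hdec := decay510_polLimit_of_eventually F (k + 1)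
      (fun K => mergedTermFamilyMatT F N (TβOfRecord₁₃ F N) (chiβOfRecord₁₃ F N θ) θ.εbg k v K) θ.ρ8 θ.bV 0 1 (hL k v hv) (hD k v hv)
    exact (secondMoment_abs_le_of_decay510 hδ hdec).2
  exact ⟨fun k v hv => (abs_le.mp (key k v hv)).1, fun k v hv => (abs_le.mp (key k v hv)).2⟩

/-- **★★ THE FINITE-VOLUME FACE AT `θ`, fundamental-domain form** (print's torus reading of (5.10): ONE pair `(C, δ₁ > 0)` bounding, for EVERY `K`, the windowed kernel on the
centred fundamental window `2|z_i| < 2L^{m+K−k−1}` of `T^{(k+1)}`, every level and box history) + W1's box limit letter ⟹ the same sign-free box.  CONDITIONAL; nothing asserted.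
[cite: Balaban1987RG1, (1.20)–(1.22) p.264, (5.10) p.293, (5.42) p.297] -/
theorem absBox_betaOfRecord₁₃_of_fundamentalDomainDecayOnBox (θ : Stage13Params F N) {γ₀ C δ₁ : ℝ} (hle : γ₀ ≤ θ.γ) (hδ : 0 < δ₁)
    (hL : letI := θ.instVβ₁; letI := θ.instVβ₂; letI := θ.instιβ
      PolLimitsExistBox F (mergedTermFamilyMatT F N (TβOfRecord₁₃ F N) (chiβOfRecord₁₃ F N θ) θ.εbg) θ.ρ8 θ.bV γ₀)
    (hD : letI := θ.instVβ₁; letI := θ.instVβ₂; letI := θ.instιβ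
      ∀ k (v : Fin (k + 1) → ℝ), v ∈ Box γ₀ k → ∀ K (z : Fin 4 → ℤ), (∀ i, 2 * |z i| < ((F.P K).sitesPerDir (k + 1) : ℤ)) →
        |polWindow F K (k + 1) (mergedTermFamilyMatT F N (TβOfRecord₁₃ F N) (chiβOfRecord₁₃ F N θ) θ.εbg k v K) θ.ρ8 θ.bV 0 1 z| ≤
          C * Real.exp (-δ₁ * l1 z)) :
    BetaLowerH (-betaPrime510 4 C δ₁) γ₀ (betaOfRecord₁₃ F N θ) ∧ BetaUpperH (betaPrime510 4 C δ₁) γ₀ (betaOfRecord₁₃ F N θ) := by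
  letI := θ.instVβ₁; letI := θ.instVβ₂; letI := θ.instιβ
  refine absBox_betaOfRecord₁₃_of_uniformEventualDecayOnBox F N θ hle hδ hL fun k v hv => ?_
  exact eventually_bound_of_fundamentalDomain F (k + 1)
    (fun K => mergedTermFamilyMatT F N (TβOfRecord₁₃ F N) (chiβOfRecord₁₃ F N θ) θ.εbg k v K) θ.ρ8 θ.bV 0 1
    (fun z => C * Real.exp (-δ₁ * l1 z)) (hD k v hv)

/-- **★★ THE FINITE-VOLUME FACE AT `θ`, moment form**: W1's box limit letter + K-EVENTUAL bounds `M` on the partial sums over each fixed finite `S ⊂ ℤ⁴` of `|Π_K(v; z) z₀ z₁|`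
⟹ the sign-free box with `β′ = M`.  CONDITIONAL; nothing asserted. [cite: Balaban1987RG1, (1.20)–(1.22) p.264] -/
theorem absBox_betaOfRecord₁₃_of_eventualAbsMomentOnBox (θ : Stage13Params F N) {γ₀ M : ℝ} (hle : γ₀ ≤ θ.γ)
    (hL : letI := θ.instVβ₁; letI := θ.instVβ₂; letI := θ.instιβ
      PolLimitsExistBox F (mergedTermFamilyMatT F N (TβOfRecord₁₃ F N) (chiβOfRecord₁₃ F N θ) θ.εbg) θ.ρ8 θ.bV γ₀)
    (hM : letI := θ.instVβ₁; letI := θ.instVβ₂; letI := θ.instιβ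
      ∀ k (v : Fin (k + 1) → ℝ), v ∈ Box γ₀ k → ∀ S : Finset (Fin 4 → ℤ), ∀ᶠ K in atTop,
        ∑ z ∈ S, |polWindow F K (k + 1) (mergedTermFamilyMatT F N (TβOfRecord₁₃ F N) (chiβOfRecord₁₃ F N θ) θ.εbg k v K) θ.ρ8 θ.bV 0 1 z *
          (z 0 : ℝ) * (z 1 : ℝ)| ≤ M) :
    BetaLowerH (-M) γ₀ (betaOfRecord₁₃ F N θ) ∧ BetaUpperH M γ₀ (betaOfRecord₁₃ F N θ) := by
  letI := θ.instVβ₁; letI := θ.instVβ₂; letI := θ.instιβ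
  have key : ∀ k (v : Fin (k + 1) → ℝ), v ∈ Box γ₀ k → |betaOfRecord₁₃ F N θ k v| ≤ M := by
    intro k v hv
    rw [betaOfRecord₁₃_eq_secondMoment_of_mem F N θ (box_mono_of_le hle hv)]
    exact (abs_secondMoment_polLimit_le_of_eventually F (k + 1)
      (fun K => mergedTermFamilyMatT F N (TβOfRecord₁₃ F N) (chiβOfRecord₁₃ F N θ) θ.εbg k v K) θ.ρ8 θ.bV 0 1 (hL k v hv) (hM k v hv)).2
  exact ⟨fun k v hv => (abs_le.mp (key k v hv)).1, fun k v hv => (abs_le.mp (key k v hv)).2⟩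

/-- **On the FULL design window, W1's record limit letter serves**: `PolLimitsExistBoxOfRecord₁₃ F N θ` (or `PolLimitsExistOfRecord₁₃ F N θ` via `.box`) IS the limit hypothesis
of the faces above at `γ₀ = θ.γ`, hence at every `γ₀ ≤ θ.γ` (`polLimitsExistBox_mono`). [cite: Balaban1987RG1, (1.21) p.264 (bookkeeping)] -/
theorem polLimitsExistBox_of_record (θ : Stage13Params F N) {γ₀ : ℝ} (hle : γ₀ ≤ θ.γ) (h : PolLimitsExistBoxOfRecord₁₃ F N θ) :
    letI := θ.instVβ₁; letI := θ.instVβ₂; letI := θ.instιβ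
    PolLimitsExistBox F (mergedTermFamilyMatT F N (TβOfRecord₁₃ F N) (chiβOfRecord₁₃ F N θ) θ.εbg) θ.ρ8 θ.bV γ₀ := by
  letI := θ.instVβ₁; letI := θ.instVβ₂; letI := θ.instιβ
  exact polLimitsExistBox_mono F _ θ.ρ8 θ.bV hle h

/-- **★ THE UNIFORM CURRENCY PAYS W1's WINDOWED DECAY LETTER OF RECORD**: ONE pair `(C, δ₁)` with K-eventual bounds on the windowed kernels at every box history of the full design
window `]0, θ.γ]` ⟹ `U3KernelLetters.WindowedDecayOfRecord₁₃ F N θ 0 1 δ₁` BY NAME (the letter asks per-sequence constants at the prefixes of window sequences; `C₀ := C`).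
[cite: Balaban1987RG1, (5.10) p.293 and (1.20) p.264] -/
theorem windowedDecayOfRecord₁₃_of_uniformEventualDecayOnBox (θ : Stage13Params F N) {C δ₁ : ℝ}
    (hD : letI := θ.instVβ₁; letI := θ.instVβ₂; letI := θ.instιβ
      ∀ k (v : Fin (k + 1) → ℝ), v ∈ Box θ.γ k → ∀ z, ∀ᶠ K in atTop,
        |polWindow F K (k + 1) (mergedTermFamilyMatT F N (TβOfRecord₁₃ F N) (chiβOfRecord₁₃ F N θ) θ.εbg k v K) θ.ρ8 θ.bV 0 1 z| ≤
          C * Real.exp (-δ₁ * l1 z)) :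
    WindowedDecayOfRecord₁₃ F N θ 0 1 δ₁ := by
  letI := θ.instVβ₁; letI := θ.instVβ₂; letI := θ.instιβ
  intro g hg
  exact ⟨C, fun k z => hD k (histPrefix g k) (mem_box.mpr fun i => by simpa using (mem_window.mp hg) i) z⟩

/-- **★ … AND (D4)'s DECAY LETTER OF RECORD**: with W1's window limit letter `PolLimitsExistOfRecord₁₃ F N θ`, the uniform currency on the full design window ⟹
`U3OfKernels.KernelDecayOfRecord₁₃ F N θ 0 1 δ₁` BY NAME — through n22's estimate-free `kernelDecayOfRecord₁₃_of_windowed`.  So ONE finite-volume delivery serves BOTH the K0 box (above)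
and the K3-keyed roads (k0-s3-w1's p610322 ∕ p611287, N17∕N22). [cite: Balaban1987RG1, (5.10) p.293 and (1.21) p.264] -/
theorem kernelDecayOfRecord₁₃_of_uniformEventualDecayOnBox (θ : Stage13Params F N) {C δ₁ : ℝ} (hL : PolLimitsExistOfRecord₁₃ F N θ)
    (hD : letI := θ.instVβ₁; letI := θ.instVβ₂; letI := θ.instιβ
      ∀ k (v : Fin (k + 1) → ℝ), v ∈ Box θ.γ k → ∀ z, ∀ᶠ K in atTop,
        |polWindow F K (k + 1) (mergedTermFamilyMatT F N (TβOfRecord₁₃ F N) (chiβOfRecord₁₃ F N θ) θ.εbg k v K) θ.ρ8 θ.bV 0 1 z| ≤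
          C * Real.exp (-δ₁ * l1 z)) :
    KernelDecayOfRecord₁₃ F N θ 0 1 δ₁ :=
  kernelDecayOfRecord₁₃_of_windowed F N θ 0 1 δ₁ hL (windowedDecayOfRecord₁₃_of_uniformEventualDecayOnBox F N θ hD)

/-- **The fundamental-domain currency pays the uniform eventual one** at the record (every level, every box history of `]0, γ₀]`). [cite: Balaban1987RG1, (5.10) p.293 (bookkeeping)] -/
theorem uniformEventualDecayOnBox_of_fundamentalDomain (θ : Stage13Params F N) {γ₀ C δ₁ : ℝ}
    (hD : letI := θ.instVβ₁; letI := θ.instVβ₂; letI := θ.instιβ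
      ∀ k (v : Fin (k + 1) → ℝ), v ∈ Box γ₀ k → ∀ K (z : Fin 4 → ℤ), (∀ i, 2 * |z i| < ((F.P K).sitesPerDir (k + 1) : ℤ)) →
        |polWindow F K (k + 1) (mergedTermFamilyMatT F N (TβOfRecord₁₃ F N) (chiβOfRecord₁₃ F N θ) θ.εbg k v K) θ.ρ8 θ.bV 0 1 z| ≤
          C * Real.exp (-δ₁ * l1 z)) :
    letI := θ.instVβ₁; letI := θ.instVβ₂; letI := θ.instιβ
    ∀ k (v : Fin (k + 1) → ℝ), v ∈ Box γ₀ k → ∀ z, ∀ᶠ K in atTop,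
      |polWindow F K (k + 1) (mergedTermFamilyMatT F N (TβOfRecord₁₃ F N) (chiβOfRecord₁₃ F N θ) θ.εbg k v K) θ.ρ8 θ.bV 0 1 z| ≤
        C * Real.exp (-δ₁ * l1 z) := by
  letI := θ.instVβ₁; letI := θ.instVβ₂; letI := θ.instιβ
  intro k v hv
  exact eventually_bound_of_fundamentalDomain F (k + 1)
    (fun K => mergedTermFamilyMatT F N (TβOfRecord₁₃ F N) (chiβOfRecord₁₃ F N θ) θ.εbg k v K) θ.ρ8 θ.bV 0 1
    (fun z => C * Real.exp (-δ₁ * l1 z)) (hD k v hv)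

end AtTheta

/-! ## §5  AT V19's SOCKET 3ᴬ′ (the (j, c)-generic collared witness `θ₁₅ᶜᶜᴹ(j)`, design box `γ = ½`): the fundamental-domain face ⟹ 3ᴬ′ BY NAME; K0⁷ BY NAME -/

section AtWitness

/-- **★★★ THE FINITE-VOLUME FACE OF 3ᴬ′, CORRECTLY WINDOWED ⟹ V19's SOCKET `AbsBetaBoxAtThm1WitnessCCMGenAt F` BY NAME.**  At every cube letter `(j, c)` and constants where the
guards and the tokens (8)∕(9) of the socket hold, SOME thresholds `ε₀, ε₂₉ > 0`, window `γ₀ ∈ ]0, ½]` and constants `C`, `δ₁ > 0` such that at the collared witness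
`θ = theta13OfThm1CCM F 2 j ε₀ ε₂₉ B₃ B₃' a₀ a₁`: (L) W1's box limit letter `PolLimitsExistBox … γ₀` — the printed limit (1.21) EXISTS for the merged term of record at every history
of `]0, γ₀]^{k+1}`, every `k`; and (FD) for every `K`, the windowed finite-torus kernel obeys `|Π_K(v; z)| ≤ C e^{−δ₁|z|₁}` on the centred FUNDAMENTAL WINDOW `2|z_i| < 2L^{m+K−k−1}`
of `T^{(k+1)}` — print's (5.10) p.293 read on the torus, uniformly in `k, K` and the history — THEN 3ᴬ′ holds at `F` with `β′ = β′₅₁₀(4; C, δ₁)`.  CONDITIONAL on (L) ∧ (FD) (displayed;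
NODE O's analysis, [I] (1.7) ∕ §5); nothing asserted; K0⁷ OPEN. [cite: Balaban1987RG1, Thm 1 p.259, §1 (1.20)–(1.22) p.264, (5.10) p.293; Balaban1985Variational, Thm 1 (8)–(9) p.279; Balaban1988Convergent, Thm 1 p.262; Balaban1989LargeFieldII, p.355] -/
theorem abs3A'_of_fundamentalDomainFaceAt (F : T4Family)
    (h : ∀ (j c : ℕ) (B₃ B₃' a₀ a₁ : ℝ), c ≤ F.L ^ j → 2 * (F.L : ℝ) ^ 2 ≤ B₃ → 0 < B₃' → 0 < a₀ → 0 < a₁ →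
      VariationalThm1RegSepCoP7M F 2 B₃ a₀ a₁ →
      Gauge9RegSepTopStepR F 2 (fun ν K Ω => suppDomOfRecord F ν K Ω) (F.L ^ j) c B₃ B₃' a₀ a₁ →
      ∃ ε₀ ε₂₉ γ₀ C δ₁ : ℝ, 0 < ε₀ ∧ 0 < ε₂₉ ∧ 0 < γ₀ ∧ γ₀ ≤ 1 / 2 ∧ 0 < δ₁ ∧
        (letI := (theta13OfThm1CCM F 2 j ε₀ ε₂₉ B₃ B₃' a₀ a₁).instVβ₁
         letI := (theta13OfThm1CCM F 2 j ε₀ ε₂₉ B₃ B₃' a₀ a₁).instVβ₂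
         letI := (theta13OfThm1CCM F 2 j ε₀ ε₂₉ B₃ B₃' a₀ a₁).instιβ
         PolLimitsExistBox F
            (mergedTermFamilyMatT F 2 (TβOfRecord₁₃ F 2) (chiβOfRecord₁₃ F 2 (theta13OfThm1CCM F 2 j ε₀ ε₂₉ B₃ B₃' a₀ a₁))
              (theta13OfThm1CCM F 2 j ε₀ ε₂₉ B₃ B₃' a₀ a₁).εbg)
            (theta13OfThm1CCM F 2 j ε₀ ε₂₉ B₃ B₃' a₀ a₁).ρ8 (theta13OfThm1CCM F 2 j ε₀ ε₂₉ B₃ B₃' a₀ a₁).bV γ₀ ∧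
         (∀ k (v : Fin (k + 1) → ℝ), v ∈ Box γ₀ k → ∀ K (z : Fin 4 → ℤ), (∀ i, 2 * |z i| < ((F.P K).sitesPerDir (k + 1) : ℤ)) →
            |polWindow F K (k + 1)
                (mergedTermFamilyMatT F 2 (TβOfRecord₁₃ F 2) (chiβOfRecord₁₃ F 2 (theta13OfThm1CCM F 2 j ε₀ ε₂₉ B₃ B₃' a₀ a₁))
                  (theta13OfThm1CCM F 2 j ε₀ ε₂₉ B₃ B₃' a₀ a₁).εbg k v K)
                (theta13OfThm1CCM F 2 j ε₀ ε₂₉ B₃ B₃' a₀ a₁).ρ8 (theta13OfThm1CCM F 2 j ε₀ ε₂₉ B₃ B₃' a₀ a₁).bV 0 1 z| ≤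
              C * Real.exp (-δ₁ * l1 z)))) :
    AbsBetaBoxAtThm1WitnessCCMGenAt F := by
  intro j c B₃ B₃' a₀ a₁ hc hB hB' ha₀ ha₁ h15 h9
  obtain ⟨ε₀, ε₂₉, γ₀, C, δ₁, hε₀, hε₂₉, hγ₀, hle, hδ, hL, hD⟩ := h j c B₃ B₃' a₀ a₁ hc hB hB' ha₀ ha₁ h15 h9
  have hle' : γ₀ ≤ (theta13OfThm1CCM F 2 j ε₀ ε₂₉ B₃ B₃' a₀ a₁).γ := by
    rw [theta13OfThm1CCM_γ]; exact hle
  exact ⟨γ₀, ε₀, ε₂₉, betaPrime510 4 C δ₁, hγ₀, hε₀, hε₂₉,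
    absBox_betaOfRecord₁₃_of_fundamentalDomainDecayOnBox F 2 _ hle' hδ hL hD⟩

/-- **★★★ K0⁷ BY NAME FROM STUB 1's TEXT AND THE FINITE-VOLUME FACE** (stub 2′ discharged by name inside `K0V19Stub2Prime`, p595104;
`record13SepCoPHInhabited_of_stub1_stub3A'_byName ∘ abs3A'_of_fundamentalDomainFaceAt`).  CONDITIONAL on stub 1's text ([15] Prop. 8 top step, displayed) and on the face (L) ∧ (FD) at
every family; nothing asserted; K0⁷ stmt-QuantumFields-20541 NOT closed by this. [cite: Balaban1985Variational, Thm 1 (8)–(9) p.279, Prop. 8 p.304; Balaban1985RegularSpaces, Prop. 6 p.99; Balaban1988Convergent, Thm 1 p.262; Balaban1987RG1, Thm 1 p.259, §1 p.264, (5.10) p.293] -/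
theorem record13SepCoPHInhabited_of_stub1_fundamentalDomainFaceAt_byName (h1 : ∀ F : T4Family, Prop8StepCoPAt F)
    (hFV : ∀ F : T4Family, ∀ (j c : ℕ) (B₃ B₃' a₀ a₁ : ℝ), c ≤ F.L ^ j → 2 * (F.L : ℝ) ^ 2 ≤ B₃ → 0 < B₃' → 0 < a₀ → 0 < a₁ →
      VariationalThm1RegSepCoP7M F 2 B₃ a₀ a₁ →
      Gauge9RegSepTopStepR F 2 (fun ν K Ω => suppDomOfRecord F ν K Ω) (F.L ^ j) c B₃ B₃' a₀ a₁ →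
      ∃ ε₀ ε₂₉ γ₀ C δ₁ : ℝ, 0 < ε₀ ∧ 0 < ε₂₉ ∧ 0 < γ₀ ∧ γ₀ ≤ 1 / 2 ∧ 0 < δ₁ ∧
        (letI := (theta13OfThm1CCM F 2 j ε₀ ε₂₉ B₃ B₃' a₀ a₁).instVβ₁
         letI := (theta13OfThm1CCM F 2 j ε₀ ε₂₉ B₃ B₃' a₀ a₁).instVβ₂
         letI := (theta13OfThm1CCM F 2 j ε₀ ε₂₉ B₃ B₃' a₀ a₁).instιβ
         PolLimitsExistBox F
            (mergedTermFamilyMatT F 2 (TβOfRecord₁₃ F 2) (chiβOfRecord₁₃ F 2 (theta13OfThm1CCM F 2 j ε₀ ε₂₉ B₃ B₃' a₀ a₁))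
              (theta13OfThm1CCM F 2 j ε₀ ε₂₉ B₃ B₃' a₀ a₁).εbg)
            (theta13OfThm1CCM F 2 j ε₀ ε₂₉ B₃ B₃' a₀ a₁).ρ8 (theta13OfThm1CCM F 2 j ε₀ ε₂₉ B₃ B₃' a₀ a₁).bV γ₀ ∧
         (∀ k (v : Fin (k + 1) → ℝ), v ∈ Box γ₀ k → ∀ K (z : Fin 4 → ℤ), (∀ i, 2 * |z i| < ((F.P K).sitesPerDir (k + 1) : ℤ)) →
            |polWindow F K (k + 1)
                (mergedTermFamilyMatT F 2 (TβOfRecord₁₃ F 2) (chiβOfRecord₁₃ F 2 (theta13OfThm1CCM F 2 j ε₀ ε₂₉ B₃ B₃' a₀ a₁))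
                  (theta13OfThm1CCM F 2 j ε₀ ε₂₉ B₃ B₃' a₀ a₁).εbg k v K)
                (theta13OfThm1CCM F 2 j ε₀ ε₂₉ B₃ B₃' a₀ a₁).ρ8 (theta13OfThm1CCM F 2 j ε₀ ε₂₉ B₃ B₃' a₀ a₁).bV 0 1 z| ≤
              C * Real.exp (-δ₁ * l1 z)))) :
    Summit.QuantumFields.YangMills.Theses.BalabanUVNodes.Record13SepCoPHInhabited :=
  record13SepCoPHInhabited_of_stub1_stub3A'_byName h1 fun F => abs3A'_of_fundamentalDomainFaceAt F (hFV F)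

end AtWitness

end Summit.QuantumFields.YangMills.Theorems.K0Stub3FinVolFace

end
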